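import Summits.NavierStokesRegularity.NavierStokesRegularity.Theorems.AxisymmetricExtremalityAxisymmetricKatoGlobalStubAxisBoundedOfLocalEnergyOrigin
import Literature.Analysis.FluidPDE.Seregin2020AxisymmetricTypeII
import Literature.Analysis.FluidPDE.AxisymmetricTypeIBounded
import Literature.Analysis.FluidPDE.SuitableWeakRescaling
import Literature.Analysis.FluidPDE.ClassicalSuitable
import Literature.Analysis.FluidPDE.SereginSverakBlowupSelection
import HarnessLib

/-!
# Route HardyPointSink — crux `HardyEnergyBound` (item stmt-NavierStokesRegularity-7979):
# a Hardy-bounded axis point of an axisymmetric solution is regular, modulo Seregin 2020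

Support file (theorems only, `--supports stmt-NavierStokesRegularity-7979`; lead c5 of the crux
line, 2026-08-17).  The local Hardy energy `∫_{B(x₀,r₀)} |u(t,x)|²/|x − x₀| dx` of the crux
`C2 = Theses.HardyPointSink.HardyEnergyBound`, taken at ONE centre `x₀`, dominates the scaled
energy `A(r) = sup_t r⁻¹ ∫_{B_r(x₀)} |u(t)|²` at EVERY scale `r ≤ r₀` (`r⁻¹ ≤ |x − x₀|⁻¹` on
`B_r(x₀)`; CKN 1982 §2), and both functionals are invariant under the Navier–Stokes scaling.
Hence, GIVEN Seregin's theorem (G. Seregin, Anal. Math. Phys. 10 (2020), Paper 46 =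
arXiv:2006.04140, Thm 2.1 — the tree's named fact `Seregin2020_axisymmetricSingularPoint_typeII`:
an axisymmetric suitable weak solution of the unit-viscosity system in the unit cylinder whose
origin is a singular point has blow-up index `g(0) = min (limsup E, limsup A, limsup C) = ∞`),
an axis point at which the local Hardy energy stays bounded up to the final time is NOT singular:

* `hardyEnergyBound_cknA_zero_rescale_le` — along the viscosity-normalising zoom
  `v = α u(T + β s, x₀ + λ y)` (`λ ≤ r₀`, `β ≤ r₀²`) the Hardy bound `≤ K` at the centre gives
  `A(r; v, 0) ≤ α² λ⁻² K` for all `0 < r ≤ 1`;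
* `hardyEnergyBound_axisTransfer` — for a suitable weak solution `(u, p)` (viscosity `ν > 0`) on
  the strip `(0, T) × ℝ³`, `u` smooth with axisymmetric slices, `p` with axisymmetric slices,
  local energy classes reaching the final time, and an axis point `x₀` with
  `∫_{B(x₀,r₀)} |u(t,x)|²/|x − x₀| dx ≤ K` for `T − r₀² < t < T`: `u` is bounded near `(T, x₀)`
  (`IsBoundedNearTop`).  This is the frame of `AxisymmetricKatoGlobal.EulerScaling.stub_typeII_transfer`
  (p153998: translation of `x₀ = b e₃` to the origin, zoom to unit viscosity on the unit cylinder,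
  transport of the three classes and of the axisymmetry, Seregin's contrapositive
  `…typeI_regular`, transport back by `Registered.isBoundedNearTop_of_eLpNorm_rescaled_lt_top`)
  with its step (6) — transfer of `limsup C` — replaced by the Hardy domination of `A`
  (`Seregin2020.blowupIndex_le_limsup_cknA`).

Used by `HardyPointSinkHardyEnergyBoundAxisymmetric.lean` (C2 ⇒ axisymmetric regularity with
swirl, modulo Seregin 2020).  References: G. Seregin, Anal. Math. Phys. 10 (2020), Paper 46,
Thm 2.1, Def. 1.7 [Seregin2020]; G. Seregin, V. Šverák, Comm. PDE 34 (2009) = arXiv:0804.1803, §4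
[SereginSverak2009]; L. Caffarelli, R. Kohn, L. Nirenberg, Comm. Pure Appl. Math. 35 (1982), §2
[CKN1982].
-/

noncomputable section

-- the summit and its single sub-problem share the name (CONVENTIONS §1), as in every Theorems file
set_option linter.dupNamespace false

open Set MeasureTheory Filter Topology Function Metric Module Literature.Analysis.FluidPDE
open scoped ENNReal NNReal

namespace Summit.NavierStokesRegularity.NavierStokesRegularity.Theorems

open AxisymmetricKatoGlobal

/-! ### The Hardy energy at the centre dominates the scaled energy of the zoom -/

/-- `a ≤ c · (a / b)` in `ℝ≥0∞` whenever `b ≤ c`, `c ≠ 0`, `c ≠ ∞` (used with `b = |x − x₀|`,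
`c = λ r` on the ball `B(x₀, λ r)`). [folklore] -/
theorem hardyEnergyBound_le_mul_div {a b c : ℝ≥0∞} (hbc : b ≤ c) (hc : c ≠ 0) (hc' : c ≠ ∞) :
    a ≤ c * (a / b) := by
  by_cases ha : a = 0
  · simp [ha]
  by_cases hb : b = 0
  · rw [hb, ENNReal.div_zero ha, ENNReal.mul_top hc]
    exact le_top
  have hb' : b ≠ ∞ := ne_top_of_le_ne_top hc' hbc
  calc a = a / b * b := (ENNReal.div_mul_cancel hb hb').symm
    _ ≤ a / b * c := mul_le_mul_right hbc _
    _ = c * (a / b) := mul_comm _ _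

/-- **The Hardy energy at the centre dominates the scaled energy at every scale, along the zoom.**
For `v = α u(T + β s, x₀ + λ y)` with `0 < λ ≤ r₀`, `0 < β ≤ r₀²`, `β < T`, a bound
`∫_{B(x₀,r₀)} |u(t,x)|²/|x − x₀| dx ≤ K` for `T − r₀² < t < T`, `t > 0`, gives
`A(r; v, 0) = sup_{−r²<s<0} r⁻¹ ∫_{B_r} |v(s,y)|² dy ≤ α² λ⁻² K` for every `0 < r ≤ 1`:
`|v(s,y)|² ≤ (λ r) |u|²/|x − x₀|` on `B_r` (`x = x₀ + λ y`, `|x − x₀| < λ r`), then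
`dy = λ⁻³ dx` and `B(x₀, λ r) ⊆ B(x₀, r₀)` (CKN 1982, §2: `A` is scale invariant; the Hardy
functional is scale invariant as well). [cite: CaffarelliKohnNirenberg1982, §2] -/
theorem hardyEnergyBound_cknA_zero_rescale_le {T β l r₀ : ℝ} {x₀ : (EuclideanSpace ℝ (Fin 3))} {u : ℝ → (EuclideanSpace ℝ (Fin 3)) → (EuclideanSpace ℝ (Fin 3))}
    {K : ℝ≥0} (α : ℝ) (hβ : 0 < β) (hl : 0 < l) (hlr₀ : l ≤ r₀) (hβr₀ : β ≤ r₀ ^ 2)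
    (hβT : β < T)
    (hH : ∀ t ∈ Ioo (T - r₀ ^ 2) T, 0 < t →
      ∫⁻ x in ball x₀ r₀, ‖u t x‖ₑ ^ 2 / ‖x - x₀‖ₑ ≤ K)
    {r : ℝ} (hr : 0 < r) (hr1 : r ≤ 1) :
    cknA r (0 : ℝ × (EuclideanSpace ℝ (Fin 3))) (α • stPull β l T x₀ u) ≤
      ‖α‖ₑ ^ 2 * ENNReal.ofReal (l ^ 2)⁻¹ * K := by
  unfold cknA
  refine iSup₂_le fun s hs => ?_
  simp only [Prod.fst_zero, Prod.snd_zero, zero_sub] at hs ⊢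
  -- the physical time `t = T + β s ∈ (T - r₀², T)`, `t > 0`
  set t : ℝ := T + β * s with ht
  have hs1 : -r ^ 2 < s := hs.1
  have hs2 : s < 0 := hs.2
  have hr2 : r ^ 2 ≤ 1 := by nlinarith
  have htT : t < T := by
    have : β * s < 0 := mul_neg_of_pos_of_neg hβ hs2
    rw [ht]; linarith
  have htlow : T - r₀ ^ 2 < t := by
    have h1 : β * (-r ^ 2) < β * s := mul_lt_mul_of_pos_left hs1 hβ
    have h2 : β * r ^ 2 ≤ β := by nlinarith
    rw [ht]; nlinarith
  have ht0 : 0 < t := by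
    have h1 : β * (-r ^ 2) < β * s := mul_lt_mul_of_pos_left hs1 hβ
    have h2 : β * r ^ 2 ≤ β := by nlinarith
    rw [ht]; nlinarith
  have hHt := hH t ⟨htlow, htT⟩ ht0
  -- the slice of the zoom
  have hvs : ∀ y : (EuclideanSpace ℝ (Fin 3)), (α • stPull β l T x₀ u) s y = α • u t (x₀ + l • y) := fun y => rfl
  -- pointwise domination on `B_r`: `|u(t, x₀ + λ y)|² ≤ (λ r) · |u|²/|x - x₀|`
  set F : (EuclideanSpace ℝ (Fin 3)) → ℝ≥0∞ := fun x => ‖u t x‖ₑ ^ 2 / ‖x - x₀‖ₑ with hF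
  have hlr : 0 < l * r := mul_pos hl hr
  have hpt : ∀ y ∈ ball (0 : (EuclideanSpace ℝ (Fin 3))) r,
      ‖(α • stPull β l T x₀ u) s y‖ₑ ^ 2 ≤
        ‖α‖ₑ ^ 2 * (ENNReal.ofReal (l * r) * F (x₀ + l • y)) := by
    intro y hy
    rw [hvs y, enorm_smul, mul_pow]
    refine mul_le_mul_right ?_ _
    have hy' : ‖y‖ < r := by simpa [mem_ball, dist_zero_right] using hy
    have hdist : ‖(x₀ + l • y) - x₀‖ₑ ≤ ENNReal.ofReal (l * r) := by
      rw [add_sub_cancel_left, ← ofReal_norm, norm_smul, Real.norm_of_nonneg hl.le]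
      exact ENNReal.ofReal_le_ofReal (mul_le_mul_of_nonneg_left hy'.le hl.le)
    simpa [hF] using
      hardyEnergyBound_le_mul_div (a := ‖u t (x₀ + l • y)‖ₑ ^ 2) hdist
        (ENNReal.ofReal_pos.2 hlr).ne' ENNReal.ofReal_ne_top
  -- integrate over `B_r` and change variables `x = x₀ + λ y`
  have hpre : (fun y : (EuclideanSpace ℝ (Fin 3)) => x₀ + l • y) ⁻¹' ball x₀ (l * r) = ball 0 r := by
    rw [space_affine_preimage_ball hl x₀ x₀ (l * r), sub_self, smul_zero,
      mul_div_cancel_left₀ r hl.ne']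
  have hcv : ∫⁻ y in ball (0 : (EuclideanSpace ℝ (Fin 3))) r, F (x₀ + l • y) =
      ENNReal.ofReal (l ^ 3)⁻¹ * ∫⁻ x in ball x₀ (l * r), F x := by
    rw [← hpre, setLIntegral_preimage_comp_space_affine hl x₀ F (ball x₀ (l * r)),
      finrank_euclideanSpace_fin]
  have hsub : ball x₀ (l * r) ⊆ ball x₀ r₀ :=
    ball_subset_ball (by nlinarith)
  have hint : ∫⁻ y in ball (0 : (EuclideanSpace ℝ (Fin 3))) r, ‖(α • stPull β l T x₀ u) s y‖ₑ ^ 2 ≤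
      ‖α‖ₑ ^ 2 * (ENNReal.ofReal (l * r) * (ENNReal.ofReal (l ^ 3)⁻¹ * K)) := by
    calc ∫⁻ y in ball (0 : (EuclideanSpace ℝ (Fin 3))) r, ‖(α • stPull β l T x₀ u) s y‖ₑ ^ 2
        ≤ ∫⁻ y in ball (0 : (EuclideanSpace ℝ (Fin 3))) r, ‖α‖ₑ ^ 2 * (ENNReal.ofReal (l * r) * F (x₀ + l • y)) :=
          setLIntegral_mono' measurableSet_ball hpt
      _ = ‖α‖ₑ ^ 2 * (ENNReal.ofReal (l * r) * ∫⁻ y in ball (0 : (EuclideanSpace ℝ (Fin 3))) r, F (x₀ + l • y)) := by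
          rw [lintegral_const_mul' _ _ (by simp), lintegral_const_mul' _ _ ENNReal.ofReal_ne_top]
      _ = ‖α‖ₑ ^ 2 * (ENNReal.ofReal (l * r) *
            (ENNReal.ofReal (l ^ 3)⁻¹ * ∫⁻ x in ball x₀ (l * r), F x)) := by rw [hcv]
      _ ≤ ‖α‖ₑ ^ 2 * (ENNReal.ofReal (l * r) * (ENNReal.ofReal (l ^ 3)⁻¹ * K)) := by
          gcongr
          exact (lintegral_mono_set hsub).trans hHt
  -- divide by `r`: `r⁻¹ · (λ r) · λ⁻³ = λ⁻²`
  have hr0 : ENNReal.ofReal r ≠ 0 := (ENNReal.ofReal_pos.2 hr).ne'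
  have hrtop : ENNReal.ofReal r ≠ ∞ := ENNReal.ofReal_ne_top
  have halg : (ENNReal.ofReal r)⁻¹ * (ENNReal.ofReal (l * r) * ENNReal.ofReal (l ^ 3)⁻¹) =
      ENNReal.ofReal (l ^ 2)⁻¹ := by
    have e1 : ENNReal.ofReal (l * r) = ENNReal.ofReal l * ENNReal.ofReal r :=
      ENNReal.ofReal_mul hl.le
    have e2 : ENNReal.ofReal l * ENNReal.ofReal (l ^ 3)⁻¹ = ENNReal.ofReal (l ^ 2)⁻¹ := by
      rw [← ENNReal.ofReal_mul hl.le]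
      congr 1
      field_simp
    rw [e1, mul_comm (ENNReal.ofReal l) (ENNReal.ofReal r), mul_assoc, ← mul_assoc,
      ENNReal.inv_mul_cancel hr0 hrtop, one_mul, e2]
  calc (ENNReal.ofReal r)⁻¹ * ∫⁻ y in ball (0 : (EuclideanSpace ℝ (Fin 3))) r, ‖(α • stPull β l T x₀ u) s y‖ₑ ^ 2
      ≤ (ENNReal.ofReal r)⁻¹ *
          (‖α‖ₑ ^ 2 * (ENNReal.ofReal (l * r) * (ENNReal.ofReal (l ^ 3)⁻¹ * K))) :=
        mul_le_mul_right hint _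
    _ = ‖α‖ₑ ^ 2 * ((ENNReal.ofReal r)⁻¹ *
          (ENNReal.ofReal (l * r) * ENNReal.ofReal (l ^ 3)⁻¹)) * K := by ring
    _ = ‖α‖ₑ ^ 2 * ENNReal.ofReal (l ^ 2)⁻¹ * K := by rw [halg]

/-! ### The transfer: a Hardy-bounded axis point is regular, modulo Seregin 2020 -/

/-- **The local Hardy bound at an axis point excludes the singularity there (modulo Seregin 2020,
Thm 2.1).**  GIVEN the named fact `Seregin2020_axisymmetricSingularPoint_typeII`, a suitable weak
solution `(u, p)` (viscosity `ν > 0`) on the strip `(0, T) × ℝ³`, `u` smooth with axisymmetric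
slices, `p` with axisymmetric slices, local energy classes reaching the final time on every
`(t₁, T) × B_ρ(0)`, whose local Hardy energy AT THE AXIS POINT `x₀` is bounded near the final
time — `∫_{B(x₀,r₀)} |u(t,x)|²/|x − x₀| dx ≤ K` for `T − r₀² < t < T`, `t > 0` — is bounded near
`(T, x₀)`.  Proof: the frame of `EulerScaling.stub_typeII_transfer` (translation of `(T, x₀)`,
`x₀ = b e₃`, to the origin; zoom `Φ(s,y) = (T + (λ²/ν)s, x₀ + λy)`, `v = (λ/ν) u ∘ Φ`,
`q = (λ/ν)² p ∘ Φ`, unit viscosity on the unit cylinder; the three classes and the axisymmetry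
transported), with the scale `λ ≤ r₀`, `λ²/ν < min (T/2, r₀²)`; the Hardy bound at the centre
dominates `A(r; v, 0) ≤ (λ/ν)² λ⁻² K` for all `r ≤ 1` (`hardyEnergyBound_cknA_zero_rescale_le`),
so `g(0) ≤ limsup A < ∞` (`Seregin2020.blowupIndex_le_limsup_cknA`) and Seregin's contrapositive
`…typeI_regular` bounds `v` essentially near the vertex; transport back
(`Registered.isBoundedNearTop_of_eLpNorm_rescaled_lt_top`). [cite: Seregin2020, Thm 2.1] -/
theorem hardyEnergyBound_axisTransfer :
    Literature.Analysis.FluidPDE.Seregin2020_axisymmetricSingularPoint_typeII →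
    ∀ ν : ℝ, 0 < ν → ∀ T : ℝ, 0 < T → ∀ (u : ℝ → EuclideanSpace ℝ (Fin 3) → EuclideanSpace ℝ (Fin 3))
      (p : ℝ → EuclideanSpace ℝ (Fin 3) → ℝ),
      ContDiffOn ℝ (⊤ : ℕ∞) (Function.uncurry u) (Set.Ioo 0 T ×ˢ Set.univ) →
      (∀ t ∈ Set.Ioo 0 T, Literature.Analysis.FluidPDE.IsAxisymmetric (u t)) →
      (∀ t ∈ Set.Ioo 0 T, Literature.Analysis.FluidPDE.IsAxisymmetricScalar (p t)) →
      Literature.Analysis.FluidPDE.IsSuitableWeakSolutionOn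
        (Literature.Analysis.FluidPDE.slab (EuclideanSpace ℝ (Fin 3)) (Set.Ioo 0 T) isOpen_Ioo) ν 0 u p →
      (∀ t₁ ∈ Set.Ioo 0 T, ∀ ρ : ℝ, 0 < ρ →
          (∃ C : NNReal, ∀ t ∈ Set.Ioo t₁ T,
              ∫⁻ x in Metric.ball (0 : EuclideanSpace ℝ (Fin 3)) ρ, ‖u t x‖ₑ ^ 2 ≤ C) ∧
          (∫⁻ z in Set.Ioo t₁ T ×ˢ Metric.ball (0 : EuclideanSpace ℝ (Fin 3)) ρ,
              ENNReal.ofReal (Literature.Analysis.FluidPDE.frobeniusNormSq (fderiv ℝ (u z.1) z.2)) < ⊤) ∧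
          (∫⁻ z in Set.Ioo t₁ T ×ˢ Metric.ball (0 : EuclideanSpace ℝ (Fin 3)) ρ,
              ‖p z.1 z.2‖ₑ ^ (3 / 2 : ℝ) < ⊤)) →
      ∀ x₀ : EuclideanSpace ℝ (Fin 3), Literature.Analysis.FluidPDE.cylRadius x₀ = 0 →
        (∃ r₀ : ℝ, 0 < r₀ ∧ ∃ K : NNReal, ∀ t ∈ Set.Ioo (T - r₀ ^ 2) T, 0 < t →
            ∫⁻ x in Metric.ball x₀ r₀, ‖u t x‖ₑ ^ 2 / ‖x - x₀‖ₑ ≤ K) →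
        Literature.Analysis.FluidPDE.IsBoundedNearTop u T x₀ := by
  -- adapted from `EulerScaling.stub_typeII_transfer`
  -- (Theorems/AxisymmetricExtremalityAxisymmetricKatoGlobalStubTypeIITransfer.lean), step (6) replaced
  intro hSer ν hν T hT u p hsm hax hpax hsw hcls x₀ hx₀ hH
  obtain ⟨r₀, hr₀, K, hK⟩ := hH
  -- the axis point is `b e₃`
  obtain ⟨b, rfl⟩ : ∃ b : ℝ, x₀ = b • eZ := ⟨x₀ 2, Registered.eq_smul_eZ_of_cylRadius_eq_zero hx₀⟩
  -- an intermediate time (within `r₀²` of `T`) and the scale (`λ ≤ r₀`)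
  set t₀ : ℝ := max (T / 2) (T - r₀ ^ 2) with ht₀def
  have ht₀ : t₀ ∈ Ioo 0 T := by
    refine ⟨lt_of_lt_of_le (by linarith) (le_max_left _ _), max_lt (by linarith) ?_⟩
    nlinarith
  have ht₀r : T - r₀ ^ 2 ≤ t₀ := le_max_right _ _
  obtain ⟨l, hl, hlr₀, -, hlT⟩ := Registered.exists_scale hν ht₀.2 hr₀
  set α : ℝ := l / ν with hαdef
  set β : ℝ := l ^ 2 / ν with hβdef
  have hα : 0 < α := by positivity
  have hβ : 0 < β := by positivity
  have hβeq : β = α * l := by rw [hβdef, hαdef]; field_simp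
  have hβt₀ : t₀ < T - β := by rw [hβdef]; linarith
  have hβr₀ : β ≤ r₀ ^ 2 := by linarith
  have hβT : β < T := by linarith [ht₀.1]
  -- the rescaled pair
  set v : ℝ → (EuclideanSpace ℝ (Fin 3)) → (EuclideanSpace ℝ (Fin 3)) := α • stPull β l T (b • eZ) u with hv
  set q : ℝ → (EuclideanSpace ℝ (Fin 3)) → ℝ := α ^ 2 • stPull β l T (b • eZ) p with hq
  have hvs : ∀ s, v s = fun y => α • u (T + β * s) (b • eZ + l • y) := fun s => by
    funext y; rfl
  -- the rescaled times lie in `(T - β, T) ⊆ (t₀, T) ⊆ (0, T)`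
  have htime : ∀ s ∈ Ioo (-1 : ℝ) 0, T + β * s ∈ Ioo t₀ T := fun s hs =>
    ⟨by nlinarith [hs.1], by nlinarith [hs.2]⟩
  have htime0 : ∀ s ∈ Ioo (-1 : ℝ) 0, T + β * s ∈ Ioo 0 T := fun s hs =>
    ⟨ht₀.1.trans (htime s hs).1, (htime s hs).2⟩
  -- (0) the unit cylinder is mapped into the strip, and into the box `(T - β, T) × B(x₀, 2λ)`
  have hparsub := Registered.parCyl_zero_one_subset_preimage_stAffine hβ hl T (b • eZ)
  have hdom : SereginSverak2009.parCylOpens 0 1 ≤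
      stPreimage β l T (b • eZ) (slab (EuclideanSpace ℝ (Fin 3)) (Ioo 0 T) isOpen_Ioo) := fun z hz => by
    have h := (mem_prod.1 (hparsub hz)).1
    rw [mem_stPreimage, mem_slab]
    exact ⟨by linarith [h.1, ht₀.1], h.2⟩
  -- the physical box lies in `(t₀, T) × B(0, ρ)`, where the classes are hypothesised
  set ρ : ℝ := ‖(b • eZ : (EuclideanSpace ℝ (Fin 3)))‖ + 2 * l with hρ
  have hρpos : 0 < ρ := by positivity
  have hballρ : ball (b • eZ : (EuclideanSpace ℝ (Fin 3))) (2 * l) ⊆ ball 0 ρ := by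
    intro x hx
    rw [mem_ball, dist_eq_norm] at hx
    rw [mem_ball, dist_zero_right, hρ]
    linarith [norm_le_norm_add_norm_sub' x (b • eZ : (EuclideanSpace ℝ (Fin 3)))]
  have hPBsub : Ioo (T - β) T ×ˢ ball (b • eZ : (EuclideanSpace ℝ (Fin 3))) (2 * l) ⊆ Ioo t₀ T ×ˢ ball 0 ρ :=
    prod_mono (Ioo_subset_Ioo_left hβt₀.le) hballρ
  obtain ⟨⟨CA, hCA⟩, hgradfin, hpresfin⟩ := hcls t₀ ht₀ ρ hρpos
  -- (1) the rescaled pair is a suitable weak solution of the unit-viscosity system on `Q(0, 1)`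
  have hsuitv : IsSuitableWeakSolutionOn (SereginSverak2009.parCylOpens 0 1) 1 0 v q := by
    have h0 := hsw.stRescale hα hl hβeq T (b • eZ)
    have hvisc : α * ν / l = 1 := by
      rw [hαdef, div_mul_cancel₀ l hν.ne', div_self hl.ne']
    have hforce : ((α ^ 2 * l) • stPull β l T (b • eZ) (0 : ℝ → (EuclideanSpace ℝ (Fin 3)) → (EuclideanSpace ℝ (Fin 3)))) = 0 := by
      funext s y; simp [stPull]
    rw [hvisc, hforce] at h0
    exact h0.of_le hdom
  -- (2) `v ∈ L_{2,∞}(Q)`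
  have hA : ∃ C : ℝ≥0, ∀ᵐ s ∂(volume.restrict (Ioo (-1 : ℝ) 0)),
      ∫⁻ y in SereginSverak2009.spaceCyl 0 1, ‖v s y‖ₑ ^ 2 ≤ C := by
    have hphys : ∀ᵐ t ∂(volume.restrict (Ioo (T + β * (-1)) (T + β * 0))),
        ∫⁻ x in ball (b • eZ : (EuclideanSpace ℝ (Fin 3))) (2 * l), ‖u t x‖ₑ ^ 2 ≤ (CA : ℝ≥0∞) := by
      refine (ae_restrict_mem measurableSet_Ioo).mono fun t ht => ?_
      exact (lintegral_mono_set hballρ).trans (hCA t ⟨by linarith [ht.1], by linarith [ht.2]⟩)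
    have h2 := ae_sliced_setLIntegral_ball_stRescale hβ hl T (b • eZ) (b • eZ) (2 * l) (-1) 0
      (fun t x => ‖u t x‖ₑ ^ 2) hphys
    have h2l : 2 * l / l = 2 := by rw [mul_div_assoc, div_self hl.ne', mul_one]
    rw [finrank_euclideanSpace_fin, sub_self, smul_zero, h2l] at h2
    set C₁ : ℝ≥0∞ := ‖α‖ₑ ^ 2 * (ENNReal.ofReal (l ^ 3)⁻¹ * CA) with hC₁
    have hC₁top : C₁ ≠ ∞ :=
      ENNReal.mul_ne_top (by simp) (ENNReal.mul_ne_top ENNReal.ofReal_ne_top ENNReal.coe_ne_top)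
    refine ⟨C₁.toNNReal, ?_⟩
    rw [ENNReal.coe_toNNReal hC₁top]
    filter_upwards [h2] with s hs
    have e : ∀ y : (EuclideanSpace ℝ (Fin 3)), ‖v s y‖ₑ ^ 2 = ‖α‖ₑ ^ 2 * ‖u (T + β * s) (b • eZ + l • y)‖ₑ ^ 2 := by
      intro y
      rw [hvs s]
      simp only [enorm_smul, mul_pow]
    simp only [e]
    rw [lintegral_const_mul' _ _ (by simp)]
    exact mul_le_mul' le_rfl
      ((lintegral_mono_set Registered.spaceCyl_zero_one_subset_ball).trans hs)
  -- (3) `∇v = (α λ) ∇u ∘ Φ ∈ L₂(Q)`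
  set G : ℝ → (EuclideanSpace ℝ (Fin 3)) → (EuclideanSpace ℝ (Fin 3)) →L[ℝ] (EuclideanSpace ℝ (Fin 3)) :=
    (α * l) • stPull β l T (b • eZ) (fun t x => fderiv ℝ (u t) x) with hG
  have hGu : HasWeakSpatialGradientOn (slab (EuclideanSpace ℝ (Fin 3)) (Ioo 0 T) isOpen_Ioo) u
      fun t x => fderiv ℝ (u t) x :=
    hasWeakSpatialGradientOn_of_contDiffOn isOpen_Ioo (by rw [coe_slab]) (hsm.of_le (by norm_cast))
  have hGv : HasWeakSpatialGradientOn (SereginSverak2009.parCylOpens 0 1) v G :=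
    (hGu.stRescale α hβ hl T (b • eZ)).mono hdom
  have hGfin : ∫⁻ z in SereginSverak2009.parCyl 0 1,
      ENNReal.ofReal (frobeniusNormSq (G z.1 z.2)) < ∞ := by
    refine lt_of_le_of_lt (lintegral_mono_set hparsub) ?_
    rw [hG, setLIntegral_frobeniusNormSq_stRescale hβ hl T (b • eZ) (α * l),
      finrank_euclideanSpace_fin]
    refine ENNReal.mul_lt_top (ENNReal.mul_lt_top ENNReal.ofReal_lt_top ENNReal.ofReal_lt_top) ?_
    exact lt_of_le_of_lt (lintegral_mono_set hPBsub) hgradfin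
  -- (4) `q ∈ L_{3/2}(Q)`
  have hqfin : ∫⁻ z in SereginSverak2009.parCyl 0 1, ‖q z.1 z.2‖ₑ ^ (3 / 2 : ℝ) < ∞ := by
    refine lt_of_le_of_lt (lintegral_mono_set hparsub) ?_
    rw [hq, setLIntegral_enorm_rpow_stRescale hβ hl T (b • eZ) (α ^ 2) p _ (by norm_num),
      finrank_euclideanSpace_fin]
    refine ENNReal.mul_lt_top (ENNReal.mul_lt_top
      (ENNReal.rpow_lt_top_of_nonneg (by norm_num) enorm_ne_top) ENNReal.ofReal_lt_top) ?_
    exact lt_of_le_of_lt (lintegral_mono_set hPBsub) hpresfin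
  -- (5) axisymmetry of the rescaled slices (`b e₃` is fixed by the rotations, which are linear)
  have hvax : ∀ s ∈ Ioo (-1 : ℝ) 0, IsAxisymmetric (v s) := fun s hs => by
    rw [hvs s]; exact SereginSverak2009.isAxisymmetric_rescale (hax _ (htime0 s hs)) α b l
  have hqax : ∀ s ∈ Ioo (-1 : ℝ) 0, IsAxisymmetricScalar (q s) := by
    intro s hs θ y
    show α ^ 2 • p (T + β * s) (b • eZ + l • rotZ θ y) = α ^ 2 • p (T + β * s) (b • eZ + l • y)
    rw [← SereginSverak2009.rotZ_smul_eZ_add_smul, hpax _ (htime0 s hs) θ]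
  -- (6) the blow-up index of `v` at the origin is finite: the Hardy energy of `u` at the centre
  -- `x₀` dominates the scaled energy `A(r; v, 0)` at every scale `r ≤ 1`
  set Cv : ℝ≥0∞ := ‖α‖ₑ ^ 2 * ENNReal.ofReal (l ^ 2)⁻¹ * K with hCv
  have hCvtop : Cv < ∞ :=
    ENNReal.mul_lt_top (ENNReal.mul_lt_top (ENNReal.pow_lt_top enorm_lt_top)
      ENNReal.ofReal_lt_top) ENNReal.coe_lt_top
  have hbound : ∀ᶠ r in 𝓝[>] (0 : ℝ), cknA r (0 : ℝ × (EuclideanSpace ℝ (Fin 3))) v ≤ Cv := by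
    filter_upwards [Ioo_mem_nhdsGT (zero_lt_one' ℝ)] with r hr
    exact hardyEnergyBound_cknA_zero_rescale_le α hβ hl hlr₀ hβr₀ hβT hK hr.1 hr.2.le
  have hlimsup : limsup (fun r => cknA r (0 : ℝ × (EuclideanSpace ℝ (Fin 3))) v) (𝓝[>] 0) ≤ Cv :=
    limsup_le_of_le (by isBoundedDefault) hbound
  have hI : Seregin2020.blowupIndex 0 v G < ∞ :=
    ((Seregin2020.blowupIndex_le_limsup_cknA 0 v G).trans hlimsup).trans_lt hCvtop
  -- (7) Seregin's theorem: `v` is essentially bounded near the vertex; transport back to `u`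
  obtain ⟨r, hr, hbd⟩ := hSer.typeI_regular hsuitv hA hGv hGfin hqfin hvax hqax hI
  exact Registered.isBoundedNearTop_of_eLpNorm_rescaled_lt_top hT hsm.continuousOn (b • eZ) hα hβ
    hl hr hbd

end Summit.NavierStokesRegularity.NavierStokesRegularity.Theorems

end
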